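import Summits.MatrixMultiplication.MatrixMultiplication.Theorems.FarEdgeDescentStratumPinning
import Literature.Computability.AlgebraicComplexity.AsymptoticRankConjecture
import HarnessLib

/-!
# Every member of the same-support stratum of `⟨2,2,2⟩` is tight and concise: the twin question is decided by Strassen's asymptotic rank conjecture

Route `FarEdgeDescent` (cell `decomp-mm`, lens 2 «structural dichotomy (special vs generic)»,
gen 33), Kernel VIII-c; support for the aside `SubLogRate` (stmt-MatrixMultiplication-25371). The
typed CONSUMER of the twist/invariant ledger of Kernels VII–VIII (critic remark r1): the
Barriers-type entry "a universal spectral point separating a generic member of the stratum from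
`⟨2,2,2⟩` refutes Strassen's asymptotic rank conjecture (tight form, CGLVW Conj. 1.4)".

Kernel VIII-b (`FarEdgeDescentStratumPinning`) pinned the stratum from below (`Q̃ = 4`, hence every
universal spectral point reads `≥ 4` on `𝔖^w`, `𝔖^{wᵀ}` and `⟨2,2,2⟩`) and showed that spectral
separation forces an excess `R̃ > 4` or `ω > 2`. Here we relabel the stratum into the cubic format
`Fin 4 × Fin 4 × Fin 4` (`cube`, along the explicit bijections `eL : Fin 4 ≃ Leaf`,
`eM : Fin 4 ≃ Mid`), check by finite computation that every member `𝔖^w`, `𝔖^{wᵀ}` (`w` nowhere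
zero) is TIGHT in the standard bases (explicit injective labels) and CONCISE (every slice has a
private support point), and conclude:

* `asymptoticRank_weightedStar_of_arc` / `…weightedTStar_of_arc` — under
  `StrassenAsymptoticRankConjecture`, `R̃(𝔖^w) = R̃(𝔖^{wᵀ}) = 4` on the whole stratum;
* `spectralPoint_weightedStar_eq_four_of_arc`, `spectralPoint_matMul_eq_four_of_arc` — under ARC
  every universal spectral point reads exactly `4` on every member and on `⟨2,2,2⟩`;
* `stratum_twins_of_arc` — **under ARC every member of the stratum is a spectral twin of
  `⟨2,2,2⟩`** (answer YES to the cell's question «ᵀ / ♭ / ♭ᵀ / 𝔖(q) ~ ⟨2,2,2⟩?» conditionally on ARC);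
* `not_arc_of_separation_from_matMul`, `not_arc_of_stratum_separation`,
  `not_arc_of_four_lt_asymptoticRank_weightedStar` — **any NO-certificate (a separating universal
  spectral point, or an excess `R̃ > 4` at one member) refutes ARC.**

So the twin question is UNDECIDED by theorem but located exactly: it is an instance of the
asymptotic rank conjecture for explicit tight concise `4 × 4 × 4` tensors, and (Kernel VIII-a/b)
under `ω = 2` it is equivalent to flatness `R̃ = 4` of the member.

References: A. Conner, F. Gesmundo, J.M. Landsberg, E. Ventura, Y. Wang, *Towards a geometric
approach to Strassen's asymptotic rank conjecture*, Collect. Math. 72 (2021), Def. 1.1, Conj. 1.4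
[ConnerGesmundoLandsbergVenturaWang2020]; P. Bürgisser, M. Clausen, M.A. Shokrollahi, *Algebraic
Complexity Theory* (1997), (14.19), Def. (15.34), Rem. (15.35) [BurgisserClausenShokrollahi1997];
M. Christandl, P. Vrana, J. Zuiddam, *Universal points in the asymptotic spectrum of tensors*,
J. AMS 36 (2023), §1.2, Prop. 1.6 [ChristandlVranaZuiddam2023]; M. Bläser, *Fast Matrix
Multiplication*, Theory of Computing Library 5 (2013), Lemma 5.4 [Blaser2013].
-/

noncomputable section

open scoped BigOperators

set_option linter.dupNamespace false

namespace Summit.MatrixMultiplication.MatrixMultiplication.Theorems.FarEdgeDescentStratumPinning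

open Literature.Computability.AlgebraicComplexity
open Literature.Barriers.MatrixMultiplication (IsConcise)
open Summit.MatrixMultiplication.MatrixMultiplication.Theorems.FarEdgeDescentTwistedStar (twistedStar)
open Summit.MatrixMultiplication.MatrixMultiplication.Theorems.FarEdgeDescentSignTwist
open Summit.MatrixMultiplication.MatrixMultiplication.Theorems.FarEdgeDescentSignStarSRank
open Summit.MatrixMultiplication.MatrixMultiplication.Theorems.FarEdgeDescentWeightFamily

/-! ## 1. The stratum in the cubic format `Fin 4 × Fin 4 × Fin 4` -/

section Cube

/-- The leaf relabelling `0 ↦ inl (0,0)`, `1 ↦ inl (1,0)`, `2 ↦ inr (0,0)`, `3 ↦ inr (1,0)`. [folklore] -/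
def eL : Fin 4 ≃ Leaf where
  toFun := ![Sum.inl (0, 0), Sum.inl (1, 0), Sum.inr (0, 0), Sum.inr (1, 0)]
  invFun := Sum.elim (fun z => if z.1 = 0 then 0 else 1) (fun z => if z.1 = 0 then 2 else 3)
  left_inv := by decide
  right_inv := by decide

/-- The middle relabelling `0 ↦ (0,0)`, `1 ↦ (0,1)`, `2 ↦ (1,0)`, `3 ↦ (1,1)`. [folklore] -/
def eM : Fin 4 ≃ Mid where
  toFun := ![(0, 0), (0, 1), (1, 0), (1, 1)]
  invFun := fun b => if b.1 = 0 then (if b.2 = 0 then 0 else 1) else (if b.2 = 0 then 2 else 3)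
  left_inv := by decide
  right_inv := by decide

/-- A stratum tensor in the cubic format `Fin 4 × Fin 4 × Fin 4` (relabelled along `eL, eM, eL`).
[cite: Blaser2013, Lemma 5.4] -/
def cube (t : Leaf → Mid → Leaf → ℂ) : Fin 4 → Fin 4 → Fin 4 → ℂ :=
  fun a b c => t (eL a) (eM b) (eL c)

/-- **Universal spectral points do not see the relabelling**: `F (cube t) = F t` (restriction in
both directions). [cite: ChristandlVranaZuiddam2023, §1.2] -/
theorem spectralPoint_cube (t : Leaf → Mid → Leaf → ℂ) {F : SpectralMap ℂ}
    (hF : IsUniversalSpectralPoint ℂ F) : F (cube t) = F t :=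
  hF.eq_of_restrictsTo (tensorRestrictsTo_precomp t eL eM eL) (tensorRestrictsTo_of_reindex t eL eM eL)

/-- **`R̃(cube t) = R̃(t)`** (`R̃ = max` over the asymptotic spectrum, which does not see the
relabelling). [cite: ChristandlVranaZuiddam2023, Prop. 1.6] -/
theorem asymptoticRank_cube (t : Leaf → Mid → Leaf → ℂ) :
    asymptoticRank (cube t) = asymptoticRank t := by
  refine le_antisymm ?_ ?_
  · obtain ⟨F, hF, hFt⟩ := (strassen_duality_asymptoticRank_holds ℂ (cube t)).2
    rw [← hFt, spectralPoint_cube t hF]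
    exact (strassen_duality_asymptoticRank_holds ℂ t).1 F hF
  · obtain ⟨F, hF, hFt⟩ := (strassen_duality_asymptoticRank_holds ℂ t).2
    rw [← hFt, ← spectralPoint_cube t hF]
    exact (strassen_duality_asymptoticRank_holds ℂ (cube t)).1 F hF

/-- The support table of `cube 𝔖^w` (`w` nowhere zero), read through Kernel VIII-b's Boolean table.
[cite: BlaserChristandlZuiddam2017, §2] -/
theorem cube_weightedStar_ne_zero_iff {w : Mid → ℂ} (hw : ∀ b, w b ≠ 0) (a b c : Fin 4) :
    cube (weightedStar ℂ 2 1 w) a b c ≠ 0 ↔ starB (eL a) (eM b) (eL c) = true := by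
  unfold cube
  rw [weightedStar_ne_zero_iff hw, mem_starSupp]

/-- The same for `cube 𝔖^{wᵀ}`. [cite: BlaserChristandlZuiddam2017, §2] -/
theorem cube_weightedTStar_ne_zero_iff {w : Mid → ℂ} (hw : ∀ b, w b ≠ 0) (a b c : Fin 4) :
    cube (weightedTStar ℂ 2 1 w) a b c ≠ 0 ↔ tstarB (eL a) (eM b) (eL c) = true := by
  unfold cube
  rw [weightedTStar_ne_zero_iff hw, mem_tstarSupp]

/-- Zero entries of `cube 𝔖^w`. [cite: BlaserChristandlZuiddam2017, §2] -/
theorem cube_weightedStar_eq_zero_iff {w : Mid → ℂ} (hw : ∀ b, w b ≠ 0) (a b c : Fin 4) :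
    cube (weightedStar ℂ 2 1 w) a b c = 0 ↔ starB (eL a) (eM b) (eL c) = false := by
  rw [Bool.eq_false_iff, ne_eq, ← cube_weightedStar_ne_zero_iff hw a b c, not_ne_iff]

/-- Zero entries of `cube 𝔖^{wᵀ}`. [cite: BlaserChristandlZuiddam2017, §2] -/
theorem cube_weightedTStar_eq_zero_iff {w : Mid → ℂ} (hw : ∀ b, w b ≠ 0) (a b c : Fin 4) :
    cube (weightedTStar ℂ 2 1 w) a b c = 0 ↔ tstarB (eL a) (eM b) (eL c) = false := by
  rw [Bool.eq_false_iff, ne_eq, ← cube_weightedTStar_ne_zero_iff hw a b c, not_ne_iff]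

end Cube

/-! ## 2. Tightness of every member (explicit injective labels) -/

section Tight

/-- **`cube 𝔖^w` is tight in the standard bases**: labels `(0,1,2,3)`, `(0,4,-1,3)`, `(0,-4,-2,-6)`
sum to zero on the eight support points. [cite: ConnerGesmundoLandsbergVenturaWang2020, Def. 1.1] -/
theorem isTightSet_cube_weightedStar {w : Mid → ℂ} (hw : ∀ b, w b ≠ 0) :
    IsTightSet (tensorSupport (cube (weightedStar ℂ 2 1 w))) := by
  refine ⟨![0, 1, 2, 3], ![0, 4, -1, 3], ![0, -4, -2, -6], by decide, by decide, by decide, ?_⟩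
  rintro ⟨a, b, c⟩ hp
  rw [mem_tensorSupport, cube_weightedStar_ne_zero_iff hw] at hp
  revert hp
  revert a b c
  decide

/-- **`cube 𝔖^{wᵀ}` is tight in the standard bases**: labels `(0,1,100,110)`, `(0,-10,-1,-11)`,
`(0,10,-100,-99)`. [cite: ConnerGesmundoLandsbergVenturaWang2020, Def. 1.1] -/
theorem isTightSet_cube_weightedTStar {w : Mid → ℂ} (hw : ∀ b, w b ≠ 0) :
    IsTightSet (tensorSupport (cube (weightedTStar ℂ 2 1 w))) := by
  refine ⟨![0, 1, 100, 110], ![0, -10, -1, -11], ![0, 10, -100, -99], by decide, by decide,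
    by decide, ?_⟩
  rintro ⟨a, b, c⟩ hp
  rw [mem_tensorSupport, cube_weightedTStar_ne_zero_iff hw] at hp
  revert hp
  revert a b c
  decide

/-- `cube 𝔖^w` is tight. [cite: ConnerGesmundoLandsbergVenturaWang2020, Def. 1.1] -/
theorem isTight_cube_weightedStar {w : Mid → ℂ} (hw : ∀ b, w b ≠ 0) :
    IsTight (cube (weightedStar ℂ 2 1 w)) :=
  IsTight.of_isTightSet (isTightSet_cube_weightedStar hw)

/-- `cube 𝔖^{wᵀ}` is tight. [cite: ConnerGesmundoLandsbergVenturaWang2020, Def. 1.1] -/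
theorem isTight_cube_weightedTStar {w : Mid → ℂ} (hw : ∀ b, w b ≠ 0) :
    IsTight (cube (weightedTStar ℂ 2 1 w)) :=
  IsTight.of_isTightSet (isTightSet_cube_weightedTStar hw)

end Tight

/-! ## 3. Conciseness of every member (private support points) -/

section Concise

/-- **Linear independence from a Boolean support table with private points.** If the zero pattern of
a family `v : Fin 4 → (X → ℂ)` is governed by a table `B` (`v a x ≠ 0 ↔ B a x`), and every `a` owns
a point `π a` lit in row `a` only, the family is linearly independent (read a vanishing combination
at `π a`). [cite: BurgisserClausenShokrollahi1997, (15.12) (proof, p. 387)] -/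
theorem linearIndependent_of_boolTable {X : Type} (v : Fin 4 → X → ℂ) (B : Fin 4 → X → Bool)
    (hv : ∀ a x, v a x ≠ 0 ↔ B a x = true) (π : Fin 4 → X) (hdiag : ∀ a, B a (π a) = true)
    (hoff : ∀ a a', a' ≠ a → B a' (π a) = false) : LinearIndependent ℂ v := by
  rw [Fintype.linearIndependent_iff]
  intro g hg a
  have h := congrFun hg (π a)
  simp only [Finset.sum_apply, Pi.smul_apply, smul_eq_mul, Pi.zero_apply] at h
  have hoff' : ∀ a', a' ≠ a → v a' (π a) = 0 := fun a' ha' => by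
    by_contra hne
    have := (hv a' (π a)).1 hne
    rw [hoff a a' ha'] at this
    exact Bool.false_ne_true this
  rw [Finset.sum_eq_single a (fun a' _ ha' => by rw [hoff' a' ha', mul_zero])
    (fun ha => absurd (Finset.mem_univ a) ha)] at h
  exact (mul_eq_zero.1 h).resolve_right ((hv a (π a)).2 (hdiag a))

/-- **`cube 𝔖^w` is concise**: private points `(b,c) = (0,0),(2,0),(0,2),(2,2)` for the four
`a`-slices, `(a,c) = (0,0),(0,1),(1,0),(1,1)` for the `b`-slices, `(a,b) = (0,0),(0,1),(2,0),(2,1)`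
for the `c`-slices. [cite: BurgisserClausenShokrollahi1997, (15.12) (proof, p. 387)] -/
theorem isConcise_cube_weightedStar {w : Mid → ℂ} (hw : ∀ b, w b ≠ 0) :
    IsConcise (cube (weightedStar ℂ 2 1 w)) := by
  refine ⟨?_, ?_, ?_⟩
  · exact linearIndependent_of_boolTable (fun a (p : Fin 4 × Fin 4) => cube _ a p.1 p.2)
      (fun a p => starB (eL a) (eM p.1) (eL p.2))
      (fun a p => cube_weightedStar_ne_zero_iff hw a p.1 p.2)
      ![(0, 0), (2, 0), (0, 2), (2, 2)] (by decide) (by decide)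
  · exact linearIndependent_of_boolTable (fun b (p : Fin 4 × Fin 4) => cube _ p.1 b p.2)
      (fun b p => starB (eL p.1) (eM b) (eL p.2))
      (fun b p => cube_weightedStar_ne_zero_iff hw p.1 b p.2)
      ![(0, 0), (0, 1), (1, 0), (1, 1)] (by decide) (by decide)
  · exact linearIndependent_of_boolTable (fun c (p : Fin 4 × Fin 4) => cube _ p.1 p.2 c)
      (fun c p => starB (eL p.1) (eM p.2) (eL c))
      (fun c p => cube_weightedStar_ne_zero_iff hw p.1 p.2 c)
      ![(0, 0), (0, 1), (2, 0), (2, 1)] (by decide) (by decide)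

/-- **`cube 𝔖^{wᵀ}` is concise**: private points `(0,0),(2,0),(0,2),(1,2)` / `(0,0),(0,1),(1,0),(1,1)`
/ `(0,0),(0,1),(2,0),(2,2)`. [cite: BurgisserClausenShokrollahi1997, (15.12) (proof, p. 387)] -/
theorem isConcise_cube_weightedTStar {w : Mid → ℂ} (hw : ∀ b, w b ≠ 0) :
    IsConcise (cube (weightedTStar ℂ 2 1 w)) := by
  refine ⟨?_, ?_, ?_⟩
  · exact linearIndependent_of_boolTable (fun a (p : Fin 4 × Fin 4) => cube _ a p.1 p.2)
      (fun a p => tstarB (eL a) (eM p.1) (eL p.2))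
      (fun a p => cube_weightedTStar_ne_zero_iff hw a p.1 p.2)
      ![(0, 0), (2, 0), (0, 2), (1, 2)] (by decide) (by decide)
  · exact linearIndependent_of_boolTable (fun b (p : Fin 4 × Fin 4) => cube _ p.1 b p.2)
      (fun b p => tstarB (eL p.1) (eM b) (eL p.2))
      (fun b p => cube_weightedTStar_ne_zero_iff hw p.1 b p.2)
      ![(0, 0), (0, 1), (1, 0), (1, 1)] (by decide) (by decide)
  · exact linearIndependent_of_boolTable (fun c (p : Fin 4 × Fin 4) => cube _ p.1 p.2 c)
      (fun c p => tstarB (eL p.1) (eM p.2) (eL c))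
      (fun c p => cube_weightedTStar_ne_zero_iff hw p.1 p.2 c)
      ![(0, 0), (0, 1), (2, 0), (2, 2)] (by decide) (by decide)

end Concise

/-! ## 4. The stratum under Strassen's asymptotic rank conjecture -/

section ARC

/-- **ARC ⟹ `R̃(𝔖^w) = 4`** for every nowhere-zero `w` (the cubic copy is tight and concise of
format `4 × 4 × 4`). [cite: ConnerGesmundoLandsbergVenturaWang2020, Conj. 1.4] -/
theorem asymptoticRank_weightedStar_of_arc (hARC : StrassenAsymptoticRankConjecture) {w : Mid → ℂ}
    (hw : ∀ b, w b ≠ 0) : asymptoticRank (weightedStar ℂ 2 1 w) = 4 := by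
  rw [← asymptoticRank_cube]
  exact_mod_cast hARC 4 _ (isConcise_cube_weightedStar hw) (isTight_cube_weightedStar hw)

/-- **ARC ⟹ `R̃(𝔖^{wᵀ}) = 4`** for every nowhere-zero `w`. [cite: ConnerGesmundoLandsbergVenturaWang2020, Conj. 1.4] -/
theorem asymptoticRank_weightedTStar_of_arc (hARC : StrassenAsymptoticRankConjecture) {w : Mid → ℂ}
    (hw : ∀ b, w b ≠ 0) : asymptoticRank (weightedTStar ℂ 2 1 w) = 4 := by
  rw [← asymptoticRank_cube]
  exact_mod_cast hARC 4 _ (isConcise_cube_weightedTStar hw) (isTight_cube_weightedTStar hw)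

/-- ARC ⟹ `R̃(𝔖^ᵀ) = 4` for the route's twisted star (lens-4's `C₁` up to relabelling). [cite: ConnerGesmundoLandsbergVenturaWang2020, Conj. 1.4] -/
theorem asymptoticRank_twistedStar_of_arc (hARC : StrassenAsymptoticRankConjecture) :
    asymptoticRank (twistedStar ℂ 2 1) = 4 := by
  rw [← weightedTStar_one]
  exact asymptoticRank_weightedTStar_of_arc hARC (fun _ => one_ne_zero)

/-- **Under ARC every universal spectral point reads exactly `4` on `𝔖^w`** (`4 ≤ F ≤ R̃ = 4`).
[cite: ChristandlVranaZuiddam2023, Prop. 1.6] -/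
theorem spectralPoint_weightedStar_eq_four_of_arc (hARC : StrassenAsymptoticRankConjecture)
    {w : Mid → ℂ} (hw : ∀ b, w b ≠ 0) {F : SpectralMap ℂ} (hF : IsUniversalSpectralPoint ℂ F) :
    F (weightedStar ℂ 2 1 w) = 4 :=
  le_antisymm (((strassen_duality_asymptoticRank_holds ℂ _).1 F hF).trans_eq
    (asymptoticRank_weightedStar_of_arc hARC hw)) (four_le_spectralPoint_weightedStar hw hF)

/-- Under ARC every universal spectral point reads exactly `4` on `𝔖^{wᵀ}`. [cite: ChristandlVranaZuiddam2023, Prop. 1.6] -/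
theorem spectralPoint_weightedTStar_eq_four_of_arc (hARC : StrassenAsymptoticRankConjecture)
    {w : Mid → ℂ} (hw : ∀ b, w b ≠ 0) {F : SpectralMap ℂ} (hF : IsUniversalSpectralPoint ℂ F) :
    F (weightedTStar ℂ 2 1 w) = 4 :=
  le_antisymm (((strassen_duality_asymptoticRank_holds ℂ _).1 F hF).trans_eq
    (asymptoticRank_weightedTStar_of_arc hARC hw)) (four_le_spectralPoint_weightedTStar hw hF)

/-- The special member: `𝔖^1` is `⟨2,2,2⟩` relabelled along `leafMM` on the two outer legs. [folklore] -/
theorem weightedStar_one_eq_matMul_leafMM :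
    weightedStar ℂ 2 1 (fun _ => 1) = fun a b c => matMulTensor ℂ 2 2 2 (leafMM a) b (leafMM c) := by
  funext a b c
  obtain ⟨b₁, b₂⟩ := b
  rcases a with ⟨i, l⟩ | ⟨i, l⟩ <;> rcases c with ⟨k, l'⟩ | ⟨k, l'⟩ <;>
    fin_cases i <;> fin_cases k <;> fin_cases b₁ <;> fin_cases b₂ <;> fin_cases l <;>
    fin_cases l' <;> simp [weightedStar, matMulTensor]

/-- **Universal spectral points agree on `⟨2,2,2⟩` and the special member `𝔖^1`** (restriction
both ways along the bijection `leafMM`). [cite: ChristandlVranaZuiddam2023, §1.2] -/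
theorem spectralPoint_matMul_eq_weightedStar_one {F : SpectralMap ℂ}
    (hF : IsUniversalSpectralPoint ℂ F) :
    F (matMulTensor ℂ 2 2 2) = F (weightedStar ℂ 2 1 (fun _ => 1)) := by
  rw [weightedStar_one_eq_matMul_leafMM]
  exact (hF.eq_of_restrictsTo
    (tensorRestrictsTo_precomp (matMulTensor ℂ 2 2 2) leafMM (Equiv.refl _) leafMM)
    (tensorRestrictsTo_of_reindex (matMulTensor ℂ 2 2 2) leafMM (Equiv.refl _) leafMM)).symm

/-- **Under ARC every universal spectral point reads exactly `4` on `⟨2,2,2⟩`** — with no appeal to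
`ω`. [cite: ConnerGesmundoLandsbergVenturaWang2020, Conj. 1.4] -/
theorem spectralPoint_matMul_eq_four_of_arc (hARC : StrassenAsymptoticRankConjecture)
    {F : SpectralMap ℂ} (hF : IsUniversalSpectralPoint ℂ F) : F (matMulTensor ℂ 2 2 2) = 4 := by
  rw [spectralPoint_matMul_eq_weightedStar_one hF]
  exact spectralPoint_weightedStar_eq_four_of_arc hARC (fun _ => one_ne_zero) hF

/-- **Under ARC the whole stratum is a spectral twin of `⟨2,2,2⟩`**: every universal spectral point
takes the same value (`4`) on `𝔖^w`, on `𝔖^{wᵀ}` and on `⟨2,2,2⟩`, for every nowhere-zero `w` — so no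
point of the asymptotic spectrum separates the classes `1`, `ᵀ`, `♭`, `♭ᵀ`, `𝔖(q)` from `⟨2,2,2⟩`.
[cite: ConnerGesmundoLandsbergVenturaWang2020, Conj. 1.4] -/
theorem stratum_twins_of_arc (hARC : StrassenAsymptoticRankConjecture) {w : Mid → ℂ}
    (hw : ∀ b, w b ≠ 0) {F : SpectralMap ℂ} (hF : IsUniversalSpectralPoint ℂ F) :
    F (weightedStar ℂ 2 1 w) = F (matMulTensor ℂ 2 2 2) ∧
      F (weightedTStar ℂ 2 1 w) = F (matMulTensor ℂ 2 2 2) := by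
  rw [spectralPoint_matMul_eq_four_of_arc hARC hF]
  exact ⟨spectralPoint_weightedStar_eq_four_of_arc hARC hw hF,
    spectralPoint_weightedTStar_eq_four_of_arc hARC hw hF⟩

/-- The named generic members under ARC: `𝔖^ᵀ`, `𝔖^♭`, `𝔖^{♭ᵀ}` and `𝔖(q)` (`q ≠ 0`) are spectral
twins of `⟨2,2,2⟩`. [cite: ConnerGesmundoLandsbergVenturaWang2020, Conj. 1.4] -/
theorem named_twins_of_arc (hARC : StrassenAsymptoticRankConjecture) {F : SpectralMap ℂ}
    (hF : IsUniversalSpectralPoint ℂ F) {q : ℂ} (hq : q ≠ 0) :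
    F (twistedStar ℂ 2 1) = F (matMulTensor ℂ 2 2 2) ∧ F (signStar ℂ) = F (matMulTensor ℂ 2 2 2) ∧
      F (signTStar ℂ) = F (matMulTensor ℂ 2 2 2) ∧ F (fam ℂ q) = F (matMulTensor ℂ 2 2 2) := by
  refine ⟨?_, (stratum_twins_of_arc hARC sgnWeight_ne_zero' hF).1,
    (stratum_twins_of_arc hARC sgnWeight_ne_zero' hF).2,
    (stratum_twins_of_arc hARC (famW_ne_zero hq) hF).1⟩
  rw [← weightedTStar_one]
  exact (stratum_twins_of_arc hARC (fun _ => one_ne_zero) hF).2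

end ARC

/-! ## 5. NO-certificates refute the asymptotic rank conjecture -/

section Refute

/-- **An excess `R̃(𝔖^w) > 4` at one nowhere-zero `w` refutes ARC.** [cite: ConnerGesmundoLandsbergVenturaWang2020, Conj. 1.4] -/
theorem not_arc_of_four_lt_asymptoticRank_weightedStar {w : Mid → ℂ} (hw : ∀ b, w b ≠ 0)
    (h : 4 < asymptoticRank (weightedStar ℂ 2 1 w)) : ¬ StrassenAsymptoticRankConjecture :=
  fun hARC => (asymptoticRank_weightedStar_of_arc hARC hw ▸ h).false

/-- An excess `R̃(𝔖^{wᵀ}) > 4` refutes ARC. [cite: ConnerGesmundoLandsbergVenturaWang2020, Conj. 1.4] -/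
theorem not_arc_of_four_lt_asymptoticRank_weightedTStar {w : Mid → ℂ} (hw : ∀ b, w b ≠ 0)
    (h : 4 < asymptoticRank (weightedTStar ℂ 2 1 w)) : ¬ StrassenAsymptoticRankConjecture :=
  fun hARC => (asymptoticRank_weightedTStar_of_arc hARC hw ▸ h).false

/-- **A universal spectral point separating `𝔖^w` from `⟨2,2,2⟩` refutes ARC.** [cite: ConnerGesmundoLandsbergVenturaWang2020, Conj. 1.4] -/
theorem not_arc_of_separation_from_matMul {w : Mid → ℂ} (hw : ∀ b, w b ≠ 0) {F : SpectralMap ℂ}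
    (hF : IsUniversalSpectralPoint ℂ F) (hsep : F (weightedStar ℂ 2 1 w) ≠ F (matMulTensor ℂ 2 2 2)) :
    ¬ StrassenAsymptoticRankConjecture :=
  fun hARC => hsep (stratum_twins_of_arc hARC hw hF).1

/-- A universal spectral point separating `𝔖^{wᵀ}` from `⟨2,2,2⟩` refutes ARC. [cite: ConnerGesmundoLandsbergVenturaWang2020, Conj. 1.4] -/
theorem not_arc_of_tseparation_from_matMul {w : Mid → ℂ} (hw : ∀ b, w b ≠ 0) {F : SpectralMap ℂ}
    (hF : IsUniversalSpectralPoint ℂ F)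
    (hsep : F (weightedTStar ℂ 2 1 w) ≠ F (matMulTensor ℂ 2 2 2)) :
    ¬ StrassenAsymptoticRankConjecture :=
  fun hARC => hsep (stratum_twins_of_arc hARC hw hF).2

/-- **A universal spectral point separating two members of the stratum refutes ARC** (any two of
`𝔖^w`, `𝔖^{w'ᵀ}`; e.g. the cell's pair `⟨2,2,2⟩ = 𝔖^1` vs `𝔖^ᵀ`). [cite: ConnerGesmundoLandsbergVenturaWang2020, Conj. 1.4] -/
theorem not_arc_of_stratum_separation {w w' : Mid → ℂ} (hw : ∀ b, w b ≠ 0) (hw' : ∀ b, w' b ≠ 0)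
    {F : SpectralMap ℂ} (hF : IsUniversalSpectralPoint ℂ F) :
    (F (weightedStar ℂ 2 1 w) ≠ F (weightedStar ℂ 2 1 w') → ¬ StrassenAsymptoticRankConjecture) ∧
    (F (weightedStar ℂ 2 1 w) ≠ F (weightedTStar ℂ 2 1 w') → ¬ StrassenAsymptoticRankConjecture) ∧
    (F (weightedTStar ℂ 2 1 w) ≠ F (weightedTStar ℂ 2 1 w') →
      ¬ StrassenAsymptoticRankConjecture) := by
  refine ⟨fun hsep hARC => hsep ?_, fun hsep hARC => hsep ?_, fun hsep hARC => hsep ?_⟩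
  · rw [(stratum_twins_of_arc hARC hw hF).1, (stratum_twins_of_arc hARC hw' hF).1]
  · rw [(stratum_twins_of_arc hARC hw hF).1, (stratum_twins_of_arc hARC hw' hF).2]
  · rw [(stratum_twins_of_arc hARC hw hF).2, (stratum_twins_of_arc hARC hw' hF).2]

/-- **The verdict on the twin question, as a dichotomy.** For every nowhere-zero `w` and every
universal spectral point `F`: either `F` reads the same on `𝔖^{wᵀ}` and on `⟨2,2,2⟩`, or Strassen's
asymptotic rank conjecture fails (witnessed by the explicit tight concise tensor `cube 𝔖^{wᵀ}` or by
`⟨2,2,2⟩ ≅ cube 𝔖^1`). [cite: ConnerGesmundoLandsbergVenturaWang2020, Conj. 1.4] -/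
theorem twin_or_not_arc {w : Mid → ℂ} (hw : ∀ b, w b ≠ 0) {F : SpectralMap ℂ}
    (hF : IsUniversalSpectralPoint ℂ F) :
    F (weightedTStar ℂ 2 1 w) = F (matMulTensor ℂ 2 2 2) ∨ ¬ StrassenAsymptoticRankConjecture := by
  by_cases h : F (weightedTStar ℂ 2 1 w) = F (matMulTensor ℂ 2 2 2)
  · exact Or.inl h
  · exact Or.inr (not_arc_of_tseparation_from_matMul hw hF h)

end Refute

end Summit.MatrixMultiplication.MatrixMultiplication.Theorems.FarEdgeDescentStratumPinning

end
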